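import Literature.Computability.QuantumComplexity.PauliExpansion
import Mathlib.LinearAlgebra.Matrix.Hermitian
import Mathlib.Algebra.BigOperators.Ring.Finset
import Mathlib.Analysis.Convex.Mul
import Mathlib.Analysis.Convex.Jensen
import HarnessLib

/-!
# Pauli expansion on a qubit register — orthogonality, Parseval, Pauli weights

Theorems about the vocabulary of `PauliExpansion.lean` (Kempe–Regev–Unger–de Wolf, Quantum Inf.
Comput. 10 (2010) 361–376, §2 [KempeEtAl2010]):

* algebra of `tensorAll` (`tensorAll_mul`, `trace_tensorAll`, `conjTranspose_tensorAll`,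
  `tensorAll_one`, linearity in one slot `tensorAll_update_add/smul/sum`);
* Pauli strings: Hermitian involutions, **trace orthogonality**
  `trace_pauliString_mul_pauliString` (`Tr(S S') = 2^{|ι|} [S = S']`, §2) and entrywise
  completeness `sum_pauliString_apply_mul_apply`;
* linearity of `pauliCoeff`; **Parseval** `sum_norm_pauliCoeff_sq`:
  `Σ_S |Tr(S M)|² = 2^{|ι|} Σ_{x,y} |M x y|²` (§2: `Tr(δ²) = 2^{-n} Σ_S δ̂(S)²`, for any complex `M`);
* `stringsOn`/`pauliWeight` API: monotonicity in the wire set (the use of Observation 3 in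
  §3.1.2, eq. (2)), the values at `∅` (`|Tr M|²`) and `univ` (Parseval), and **convexity**
  `pauliWeight_sum_smul_le` (Observation 6).

## References

* [KempeEtAl2010] J. Kempe, O. Regev, F. Unger, R. de Wolf, Quantum Inf. Comput. 10 (2010)
  361–376; arXiv:0802.1464, §2, Observations 3 and 6, §3.1.
-/

noncomputable section

open Matrix Finset

namespace Literature.Computability.QuantumComplexity

variable {ι : Type*} [Fintype ι] [DecidableEq ι]

/-! ### Algebra of `tensorAll` -/

/-- `(⊗ Aᵢ)(⊗ Bᵢ) = ⊗ (Aᵢ Bᵢ)`. [folklore] -/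
theorem tensorAll_mul (A B : ι → Matrix Bool Bool ℂ) :
    tensorAll A * tensorAll B = tensorAll fun i => A i * B i := by
  ext x z
  simp only [Matrix.mul_apply, tensorAll_apply]
  rw [Fintype.prod_sum (fun i b => A i (x i) b * B i b (z i))]
  refine Finset.sum_congr rfl fun y _ => ?_
  rw [← Finset.prod_mul_distrib]

/-- `Tr(⊗ Aᵢ) = ∏ Tr(Aᵢ)`. [folklore] -/
theorem trace_tensorAll (A : ι → Matrix Bool Bool ℂ) :
    (tensorAll A).trace = ∏ i, (A i).trace := by
  simp only [Matrix.trace, Matrix.diag_apply, tensorAll_apply]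
  rw [Fintype.prod_sum (fun i b => A i b b)]

omit [DecidableEq ι] in
/-- `(⊗ Aᵢ)ᴴ = ⊗ Aᵢᴴ`. [folklore] -/
theorem conjTranspose_tensorAll (A : ι → Matrix Bool Bool ℂ) :
    (tensorAll A)ᴴ = tensorAll fun i => (A i)ᴴ := by
  ext x y
  simp [Matrix.conjTranspose_apply, tensorAll_apply, star_prod]

omit [DecidableEq ι] in
/-- `⊗ 1 = 1`. [folklore] -/
theorem tensorAll_one : tensorAll (fun _ : ι => (1 : Matrix Bool Bool ℂ)) = 1 := by
  ext x y
  simp only [tensorAll_apply, Matrix.one_apply]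
  rw [Finset.prod_boole]
  simp only [Finset.mem_univ, true_implies, funext_iff]

/-- Entries of a tensor product with one slot replaced: the slot factor comes out.
[folklore] -/
theorem tensorAll_update_apply (A : ι → Matrix Bool Bool ℂ) (j : ι) (B : Matrix Bool Bool ℂ)
    (x y : ι → Bool) :
    tensorAll (Function.update A j B) x y = B (x j) (y j) * ∏ i ∈ Finset.univ.erase j, A i (x i) (y i) := by
  rw [tensorAll_apply]
  have : (fun i => Function.update A j B i (x i) (y i)) =
      Function.update (fun i => A i (x i) (y i)) j (B (x j) (y j)) := by
    funext i
    by_cases h : i = j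
    · subst h; simp
    · simp [Function.update_of_ne h]
  rw [this, Finset.prod_update_of_mem (Finset.mem_univ j), Finset.sdiff_singleton_eq_erase]

/-- Linearity of `tensorAll` in one slot (sums). [folklore] -/
theorem tensorAll_update_add (A : ι → Matrix Bool Bool ℂ) (j : ι) (B C : Matrix Bool Bool ℂ) :
    tensorAll (Function.update A j (B + C)) =
      tensorAll (Function.update A j B) + tensorAll (Function.update A j C) := by
  ext x y
  simp only [Matrix.add_apply, tensorAll_update_apply, add_mul]

/-- Linearity of `tensorAll` in one slot (scalars). [folklore] -/
theorem tensorAll_update_smul (A : ι → Matrix Bool Bool ℂ) (j : ι) (c : ℂ) (B : Matrix Bool Bool ℂ) :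
    tensorAll (Function.update A j (c • B)) = c • tensorAll (Function.update A j B) := by
  ext x y
  simp only [Matrix.smul_apply, tensorAll_update_apply, smul_eq_mul, mul_assoc]

/-- Linearity of `tensorAll` in one slot (finite sums). [folklore] -/
theorem tensorAll_update_sum {κ : Type*} (s : Finset κ) (A : ι → Matrix Bool Bool ℂ) (j : ι)
    (B : κ → Matrix Bool Bool ℂ) :
    tensorAll (Function.update A j (∑ k ∈ s, B k)) = ∑ k ∈ s, tensorAll (Function.update A j (B k)) := by
  classical
  induction s using Finset.induction_on with
  | empty =>
    rw [Finset.sum_empty, Finset.sum_empty]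
    ext x y
    simp only [tensorAll_update_apply, Matrix.zero_apply, zero_mul]
  | insert k s hk ih =>
    rw [Finset.sum_insert hk, Finset.sum_insert hk, tensorAll_update_add, ih]

/-- Updating the same slot twice. [folklore] -/
theorem tensorAll_update_update (A : ι → Matrix Bool Bool ℂ) (j : ι) (B C : Matrix Bool Bool ℂ) :
    tensorAll (Function.update (Function.update A j B) j C) = tensorAll (Function.update A j C) := by
  rw [Function.update_idem]

/-! ### Pauli strings -/

omit [DecidableEq ι] in
/-- The identity string is the identity matrix. [folklore] -/
@[simp] theorem pauliString_const_I : pauliString (fun _ : ι => Pauli.I) = 1 := by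
  rw [pauliString_eq]
  exact tensorAll_one

omit [DecidableEq ι] in
/-- Pauli strings are Hermitian. [cite: KempeEtAl2010, §2] -/
theorem conjTranspose_pauliString (S : ι → Pauli) : (pauliString S)ᴴ = pauliString S := by
  rw [pauliString_eq, conjTranspose_tensorAll]
  simp only [Pauli.conjTranspose_mat]

/-- Pauli strings are involutions. [cite: KempeEtAl2010, §2] -/
theorem pauliString_mul_self (S : ι → Pauli) : pauliString S * pauliString S = 1 := by
  rw [pauliString_eq, tensorAll_mul]
  simp only [Pauli.mat_mul_self]
  exact tensorAll_one

/-- **Trace orthogonality of Pauli strings**: `Tr(S S') = 2^{|ι|}` if `S = S'` and `0` otherwise.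
[cite: KempeEtAl2010, §2 (Tr(SS') = 2ⁿ if S = S' and 0 otherwise)] -/
theorem trace_pauliString_mul_pauliString (S S' : ι → Pauli) :
    (pauliString S * pauliString S').trace = if S = S' then (2 : ℂ) ^ Fintype.card ι else 0 := by
  rw [pauliString_eq, pauliString_eq, tensorAll_mul, trace_tensorAll]
  simp only [Pauli.trace_mat_mul_mat]
  by_cases h : S = S'
  · subst h
    simp [Finset.prod_const, Finset.card_univ]
  · rw [if_neg h]
    obtain ⟨i, hi⟩ : ∃ i, S i ≠ S' i := by
      by_contra hc
      push Not at hc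
      exact h (funext hc)
    exact Finset.prod_eq_zero (Finset.mem_univ i) (if_neg hi)

/-! ### Pauli coefficients -/

/-- The coefficient of the identity string is the trace. [cite: KempeEtAl2010, Observation 3] -/
@[simp] theorem pauliCoeff_const_I (M : Matrix (ι → Bool) (ι → Bool) ℂ) :
    pauliCoeff M (fun _ => Pauli.I) = M.trace := by
  rw [pauliCoeff_eq, pauliString_const_I, Matrix.one_mul]

/-- `pauliCoeff` is additive in the matrix. [folklore] -/
theorem pauliCoeff_add (M N : Matrix (ι → Bool) (ι → Bool) ℂ) (S : ι → Pauli) :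
    pauliCoeff (M + N) S = pauliCoeff M S + pauliCoeff N S := by
  simp [pauliCoeff_eq, Matrix.mul_add, Matrix.trace_add]

/-- `pauliCoeff` is homogeneous in the matrix. [folklore] -/
theorem pauliCoeff_smul (c : ℂ) (M : Matrix (ι → Bool) (ι → Bool) ℂ) (S : ι → Pauli) :
    pauliCoeff (c • M) S = c * pauliCoeff M S := by
  simp [pauliCoeff_eq, Matrix.trace_smul]

/-- `pauliCoeff` of a difference. [folklore] -/
theorem pauliCoeff_sub (M N : Matrix (ι → Bool) (ι → Bool) ℂ) (S : ι → Pauli) :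
    pauliCoeff (M - N) S = pauliCoeff M S - pauliCoeff N S := by
  simp [pauliCoeff_eq, Matrix.mul_sub, Matrix.trace_sub]

/-- `pauliCoeff` of a finite sum. [folklore] -/
theorem pauliCoeff_sum {κ : Type*} (s : Finset κ) (M : κ → Matrix (ι → Bool) (ι → Bool) ℂ)
    (S : ι → Pauli) : pauliCoeff (∑ k ∈ s, M k) S = ∑ k ∈ s, pauliCoeff (M k) S := by
  simp [pauliCoeff_eq, Finset.mul_sum, Matrix.trace_sum]

/-! ### Parseval -/

/-- Entrywise completeness of the Pauli strings:
`Σ_S S_{xy} S_{y'x'} = 2^{|ι|} [x = x'] [y = y']`. [cite: KempeEtAl2010, §2 (𝒫ⁿ is an orthogonal basis)] -/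
theorem sum_pauliString_apply_mul_apply (x y x' y' : ι → Bool) :
    ∑ S : ι → Pauli, pauliString S x y * pauliString S y' x' =
      if x = x' ∧ y = y' then (2 : ℂ) ^ Fintype.card ι else 0 := by
  classical
  simp only [pauliString_eq, tensorAll_apply, ← Finset.prod_mul_distrib]
  rw [← Fintype.prod_sum (fun i Q => Pauli.mat Q (x i) (y i) * Pauli.mat Q (y' i) (x' i))]
  simp only [Pauli.sum_mat_mul_mat]
  by_cases h : x = x' ∧ y = y'
  · obtain ⟨rfl, rfl⟩ := h
    simp [Finset.prod_const, Finset.card_univ]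
  · rw [if_neg h]
    have : ∃ i, ¬ (x i = x' i ∧ y i = y' i) := by
      by_contra hc
      push Not at hc
      exact h ⟨funext fun i => (hc i).1, funext fun i => (hc i).2⟩
    obtain ⟨i, hi⟩ := this
    exact Finset.prod_eq_zero (Finset.mem_univ i) (if_neg hi)

/-- Entrywise completeness, conjugate form: `Σ_S S_{xy} conj(S_{x'y'}) = 2^{|ι|} [x = x'] [y = y']`.
[cite: KempeEtAl2010, §2 (𝒫ⁿ is an orthogonal basis)] -/
theorem sum_pauliString_apply_mul_star_apply (x y x' y' : ι → Bool) :
    ∑ S : ι → Pauli, pauliString S x y * star (pauliString S x' y') =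
      if x = x' ∧ y = y' then (2 : ℂ) ^ Fintype.card ι else 0 := by
  have h : ∀ S : ι → Pauli, star (pauliString S x' y') = pauliString S y' x' := fun S => by
    have := congrFun (congrFun (conjTranspose_pauliString S) y') x'
    rwa [Matrix.conjTranspose_apply] at this
  simp only [h]
  exact sum_pauliString_apply_mul_apply x y x' y'

/-- **Parseval for the Pauli expansion**: `Σ_S |Tr(S M)|² = 2^{|ι|} Σ_{x,y} |M x y|²`
(the Pauli strings form an orthogonal basis with `⟨S, S⟩ = 2^{|ι|}`).
[cite: KempeEtAl2010, §2 (Tr(δ²) = 2^{-n} Σ_S δ̂(S)²) and Observation 2] -/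
theorem sum_norm_pauliCoeff_sq (M : Matrix (ι → Bool) (ι → Bool) ℂ) :
    ∑ S : ι → Pauli, ‖pauliCoeff M S‖ ^ 2 = (2 : ℝ) ^ Fintype.card ι * ∑ x, ∑ y, ‖M x y‖ ^ 2 := by
  classical
  -- the coefficient as a single sum over pairs of basis labels
  have hc : ∀ S : ι → Pauli, pauliCoeff M S =
      ∑ p : (ι → Bool) × (ι → Bool), pauliString S p.1 p.2 * M p.2 p.1 := by
    intro S
    rw [pauliCoeff_eq, Matrix.trace, Fintype.sum_prod_type]
    simp only [Matrix.diag_apply, Matrix.mul_apply]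
  -- the sum over strings of one quadruple term
  have inner : ∀ p q : (ι → Bool) × (ι → Bool),
      ∑ S : ι → Pauli, pauliString S p.1 p.2 * M p.2 p.1 *
        ((starRingEnd ℂ) (pauliString S q.1 q.2) * (starRingEnd ℂ) (M q.2 q.1)) =
      if p = q then (2 : ℂ) ^ Fintype.card ι * (M p.2 p.1 * (starRingEnd ℂ) (M p.2 p.1)) else 0 := by
    intro p q
    have : ∀ S : ι → Pauli, pauliString S p.1 p.2 * M p.2 p.1 *
        ((starRingEnd ℂ) (pauliString S q.1 q.2) * (starRingEnd ℂ) (M q.2 q.1)) =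
        (M p.2 p.1 * (starRingEnd ℂ) (M q.2 q.1)) *
          (pauliString S p.1 p.2 * star (pauliString S q.1 q.2)) := by
      intro S; rw [Complex.star_def]; ring
    simp only [this, ← Finset.mul_sum, sum_pauliString_apply_mul_star_apply]
    by_cases h : p = q
    · subst h; simp only [and_self, if_true]; ring
    · rw [if_neg h, if_neg, mul_zero]
      exact fun h' => h (Prod.ext h'.1 h'.2)
  -- notation for the quadruple terms
  set t : (ι → Pauli) → (ι → Bool) × (ι → Bool) → (ι → Bool) × (ι → Bool) → ℂ := fun S p q =>
    pauliString S p.1 p.2 * M p.2 p.1 *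
      ((starRingEnd ℂ) (pauliString S q.1 q.2) * (starRingEnd ℂ) (M q.2 q.1)) with ht
  have h1 : ∀ S : ι → Pauli, pauliCoeff M S * (starRingEnd ℂ) (pauliCoeff M S) = ∑ p, ∑ q, t S p q := by
    intro S
    rw [hc, map_sum, Finset.sum_mul_sum]
    refine Finset.sum_congr rfl fun p _ => Finset.sum_congr rfl fun q _ => ?_
    rw [ht, map_mul]
  have h2 : ∑ S : ι → Pauli, ∑ p, ∑ q, t S p q =
      ∑ p : (ι → Bool) × (ι → Bool), ∑ q : (ι → Bool) × (ι → Bool), ∑ S : ι → Pauli, t S p q :=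
    Finset.sum_comm.trans (Finset.sum_congr rfl fun p _ => Finset.sum_comm)
  apply Complex.ofReal_injective
  push_cast
  simp only [← Complex.mul_conj', h1]
  rw [h2]
  simp only [ht, inner, Finset.sum_ite_eq, Finset.mem_univ, if_true, ← Finset.mul_sum]
  congr 1
  rw [Fintype.sum_prod_type, Finset.sum_comm]

/-! ### Strings on a wire set and Pauli weights -/

/-- `stringsOn` is monotone. [folklore] -/
theorem stringsOn_mono {W W' : Finset ι} (h : W ⊆ W') : stringsOn W ⊆ stringsOn W' :=
  fun _ hS => mem_stringsOn.2 fun i hi => mem_stringsOn.1 hS i fun hi' => hi (h hi')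

/-- Only the identity string is supported in `∅`. [folklore] -/
theorem stringsOn_empty : stringsOn (∅ : Finset ι) = {fun _ => Pauli.I} := by
  ext S
  simp only [mem_stringsOn, Finset.notMem_empty, not_false_eq_true, true_implies,
    Finset.mem_singleton, funext_iff]

/-- Every string is supported in the full wire set. [folklore] -/
theorem stringsOn_univ : stringsOn (Finset.univ : Finset ι) = Finset.univ := by
  ext S
  simp [mem_stringsOn]

/-- Pauli weights are nonnegative. [folklore] -/
theorem pauliWeight_nonneg (M : Matrix (ι → Bool) (ι → Bool) ℂ) (W : Finset ι) :
    0 ≤ pauliWeight M W :=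
  Finset.sum_nonneg fun _ _ => by positivity

/-- Pauli weights are monotone in the wire set (the sum runs over more strings); this is the
use of Observation 3 in Case 1 of the proof of Lemma 7.
[cite: KempeEtAl2010, §3.1.2 eq. (lefthand)] -/
theorem pauliWeight_mono (M : Matrix (ι → Bool) (ι → Bool) ℂ) {W W' : Finset ι} (h : W ⊆ W') :
    pauliWeight M W ≤ pauliWeight M W' :=
  Finset.sum_le_sum_of_subset_of_nonneg (stringsOn_mono h) fun _ _ _ => by positivity

/-- A single coefficient is bounded by the weight of any wire set supporting it.
[folklore] -/
theorem norm_pauliCoeff_sq_le_pauliWeight (M : Matrix (ι → Bool) (ι → Bool) ℂ) {W : Finset ι}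
    {S : ι → Pauli} (hS : S ∈ stringsOn W) : ‖pauliCoeff M S‖ ^ 2 ≤ pauliWeight M W :=
  Finset.single_le_sum (f := fun S => ‖pauliCoeff M S‖ ^ 2) (fun _ _ => by positivity) hS

/-- On the empty wire set the weight is `|Tr M|²`. [cite: KempeEtAl2010, §3.1.1 (V = ∅)] -/
theorem pauliWeight_empty (M : Matrix (ι → Bool) (ι → Bool) ℂ) :
    pauliWeight M ∅ = ‖M.trace‖ ^ 2 := by
  rw [pauliWeight_eq, stringsOn_empty, Finset.sum_singleton, pauliCoeff_const_I]

/-- On the full wire set the weight is `2^{|ι|} ‖M‖²_{HS}` (Parseval).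
[cite: KempeEtAl2010, §2 (Tr(δ²) = 2^{-n} Σ_S δ̂(S)²)] -/
theorem pauliWeight_univ (M : Matrix (ι → Bool) (ι → Bool) ℂ) :
    pauliWeight M Finset.univ = (2 : ℝ) ^ Fintype.card ι * ∑ x, ∑ y, ‖M x y‖ ^ 2 := by
  rw [pauliWeight_eq, stringsOn_univ, sum_norm_pauliCoeff_sq]

/-- The weight of a difference vanishes on `∅` when the traces agree. [folklore] -/
theorem pauliWeight_empty_eq_zero {M : Matrix (ι → Bool) (ι → Bool) ℂ} (h : M.trace = 0) :
    pauliWeight M ∅ = 0 := by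
  rw [pauliWeight_empty, h, norm_zero]; ring

/-- **Convexity** (Observation 6): the weight of a probabilistic mixture is at most the mixture
of the weights, `Σ_S |Σ_k w_k M̂_k(S)|² ≤ Σ_k w_k Σ_S |M̂_k(S)|²`.
[cite: KempeEtAl2010, Observation 6] -/
theorem pauliWeight_sum_smul_le {κ : Type*} (s : Finset κ) (w : κ → ℝ) (hw : ∀ k ∈ s, 0 ≤ w k)
    (hw1 : ∑ k ∈ s, w k = 1) (M : κ → Matrix (ι → Bool) (ι → Bool) ℂ) (W : Finset ι) :
    pauliWeight (∑ k ∈ s, ((w k : ℝ) : ℂ) • M k) W ≤ ∑ k ∈ s, w k * pauliWeight (M k) W := by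
  simp only [pauliWeight_eq, Finset.mul_sum]
  rw [Finset.sum_comm]
  refine Finset.sum_le_sum fun S _ => ?_
  rw [pauliCoeff_sum]
  simp only [pauliCoeff_smul]
  -- `|Σ w_k c_k|² ≤ (Σ w_k |c_k|)² ≤ Σ w_k |c_k|²`
  have h1 : ‖∑ k ∈ s, (w k : ℂ) * pauliCoeff (M k) S‖ ≤ ∑ k ∈ s, w k * ‖pauliCoeff (M k) S‖ := by
    refine (norm_sum_le _ _).trans (le_of_eq (Finset.sum_congr rfl fun k hk => ?_))
    rw [norm_mul, Complex.norm_real, Real.norm_of_nonneg (hw k hk)]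
  have h2 : (∑ k ∈ s, w k * ‖pauliCoeff (M k) S‖) ^ 2 ≤
      ∑ k ∈ s, w k * ‖pauliCoeff (M k) S‖ ^ 2 := by
    have h := (convexOn_pow 2).map_sum_le hw hw1
      (fun k _ => Set.mem_Ici.2 (norm_nonneg (pauliCoeff (M k) S)))
    simpa only [smul_eq_mul] using h
  calc ‖∑ k ∈ s, (w k : ℂ) * pauliCoeff (M k) S‖ ^ 2
      ≤ (∑ k ∈ s, w k * ‖pauliCoeff (M k) S‖) ^ 2 := by
        gcongr
    _ ≤ ∑ k ∈ s, w k * ‖pauliCoeff (M k) S‖ ^ 2 := h2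

end Literature.Computability.QuantumComplexity
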